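import Summits.QuantumFields.YangMills.Theorems.IR.TypFormatRobust
import Summits.QuantumFields.YangMills.Theorems.IR.AfPincerUcSharpOnset
import HarnessLib

/-!
# Crux `IR` (stmt-QuantumFields-19354), lane B: GRADE ROBUSTNESS OF THE SHARP TYPICAL ONSET I♯_SC (`OnsetSharpUKPcSC`) BY NAME

Helper module for item `stmt-QuantumFields-19354` (`--supports`; it closes nothing).  By-name corollaries of the typical bootstrap
(`Theorems/IR/TypFormatBootstrap.lean`, `TypFormatRobust.lean`) for the slot's calibrated statement
`AfPincerUc.SharpOnset.OnsetSharpUKPcSC` (`Theorems/IR/AfPincerUcSharpOnset.lean` :67 — the type of the formerly registered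
`stub_onsetSharpSC`; the slot's `TypShellCondUKPc` is the tree mirror by `typShellCondUKPc_iff_mirror`, `Iff.rfl`):

* `exists_budget` — the rarity budget `δ₀ = min δ ((ε' − θ^j)/(jK+1))` absorbing the bad-cell term of the bootstrap;
  `typShellCondUKPc_point_robust` — ONE mesh: `TypShellCondUKPc ρ β b n ε δ₀ ⇒ TypShellCondUKPc ρ β b (j(2n+1)) ε' δ`.
* **`sharpFamily_grade_free`** — a CALIBRATED typical-onset family `∀ δ > 0, ∃ T β₂, ∀ β ≥ β₂, ∃ b ≥ 1, a(β)·b < T ∧ TypShellCondUKPc …`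
  at any grade `(n, ε)` with `ε·shellCount n < 1` holds at a grade `(n', ε')` with `ε'·shellCount n' < τ` for EVERY `τ > 0` —
  same meshes, same calibration constants `T(δ₀)`.
* **`onsetSharpUKPcSC_iff_lt_one`** — in I♯_SC the registered admissibility `ε·shellCount n ≤ 3/4` is equivalent to the
  Dobrushin–Shlosman threshold `< 1`; **`onsetSharpUKPcSC_grade_free`** — I♯_SC delivers the calibrated family below ANY target `τ`.

HONEST FRAMING: format-level corollaries about an OPEN statement (weak-coupling typical-class mixing at a calibrated mesh) of a
CONDITIONAL chain; nothing here proves it; not a gap, not Clay.  No `sorry`; axioms ⊆ {propext, Classical.choice, Quot.sound}.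
-/

set_option autoImplicit false

noncomputable section

open MeasureTheory Filter Topology
open Literature.MathematicalPhysics
open Literature.MathematicalPhysics.QuantumFieldTheory Literature.MathematicalPhysics.QuantumLattice
open Summit.QuantumFields.YangMills.Cruxes.OSLegsFromFemtoAndGap.DlrCollarTransfer (LowerBounds)
open Summit.QuantumFields.YangMills.Cruxes.IR.OnsetFormats (shellCount)
open Summit.QuantumFields.YangMills.Cruxes.IR.OnsetFormatsUc.TypBootstrap (typShellCondUKPc_bootstrap typShellCondUKPc_mono)
open Summit.QuantumFields.YangMills.Cruxes.IR.OnsetFormatsUc.TypRobust (exists_bootstrap_exponent_lt)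

namespace Summit.QuantumFields.YangMills.Cruxes.IR.AfPincerUc.SharpOnset

open Summit.QuantumFields.YangMills.Cruxes.IR.AfPincerUc

/-- **The rarity budget of the bootstrap**: for `ε' > θ^j`, `δ > 0`, `K ≥ 0` there is `δ₀ ∈ (0, δ]` with `θ^j + j·K·δ₀ ≤ ε'`. -/
theorem exists_budget {θ K ε' δ : ℝ} {j : ℕ} (hK : 0 ≤ K) (hε' : θ ^ j < ε') (hδ : 0 < δ) :
    ∃ δ₀ : ℝ, 0 < δ₀ ∧ δ₀ ≤ δ ∧ θ ^ j + (j : ℝ) * (K * δ₀) ≤ ε' := by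
  have hjK : 0 < (j : ℝ) * K + 1 := by positivity
  refine ⟨min δ ((ε' - θ ^ j) / ((j : ℝ) * K + 1)), lt_min hδ (div_pos (by linarith) hjK), min_le_left _ _, ?_⟩
  have h1 : min δ ((ε' - θ ^ j) / ((j : ℝ) * K + 1)) ≤ (ε' - θ ^ j) / ((j : ℝ) * K + 1) := min_le_right _ _
  have h2 : ((j : ℝ) * K) * min δ ((ε' - θ ^ j) / ((j : ℝ) * K + 1)) ≤
      ((j : ℝ) * K) * ((ε' - θ ^ j) / ((j : ℝ) * K + 1)) := mul_le_mul_of_nonneg_left h1 (by positivity)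
  have h3 : ((j : ℝ) * K) * ((ε' - θ ^ j) / ((j : ℝ) * K + 1)) ≤ ε' - θ ^ j := by
    rw [mul_div_assoc', div_le_iff₀ hjK]
    nlinarith [hK, (Nat.cast_nonneg j : (0 : ℝ) ≤ j)]
  have e : (j : ℝ) * (K * min δ ((ε' - θ ^ j) / ((j : ℝ) * K + 1))) =
      ((j : ℝ) * K) * min δ ((ε' - θ ^ j) / ((j : ℝ) * K + 1)) := by ring
  rw [e]
  linarith

section Point

variable {G : Type} [Group G] [TopologicalSpace G] [IsTopologicalGroup G] [CompactSpace G]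
  [MeasurableSpace G] [BorelSpace G] [SecondCountableTopology G] [T2Space G]
  {N : ℕ} {ρ : G →* Matrix (Fin N) (Fin N) ℂ}

/-- **One-mesh robustness** (slot currency): `TypShellCondUKPc ρ β b n ε δ₀`, `0 < δ₀ ≤ δ`,
`(ε·shellCount n)^j + j(2+3ε)·shellCount n·δ₀ ≤ ε'` ⇒ `TypShellCondUKPc ρ β b (j(2n+1)) ε' δ` (bootstrap, then monotonicity). -/
theorem typShellCondUKPc_point_robust (hρ : Continuous ρ) {β : ℝ} {b n : ℕ} {ε ε' δ₀ δ : ℝ} (hb : 1 ≤ b) (hε : 0 ≤ ε)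
    (hεM : ε * shellCount n ≤ 1) (hδ₀ : 0 < δ₀) (hδ₀δ : δ₀ ≤ δ) (j : ℕ)
    (hε' : (ε * shellCount n) ^ j + (j : ℝ) * ((2 + 3 * ε) * shellCount n * δ₀) ≤ ε')
    (hT : TypShellCondUKPc ρ β b n ε δ₀) : TypShellCondUKPc ρ β b (j * (2 * n + 1)) ε' δ :=
  (typShellCondUKPc_iff_mirror ρ β b _ ε' δ).mpr
    (typShellCondUKPc_mono ρ hε' hδ₀.le hδ₀δ
      (typShellCondUKPc_bootstrap ρ hρ hb hε hεM hδ₀.le ((typShellCondUKPc_iff_mirror ρ β b n ε δ₀).mp hT) j))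

/-- **Grade freedom of a CALIBRATED typical-onset family** (slot currency): a family
`∀ δ > 0, ∃ T β₂, ∀ β ≥ β₂, ∃ b ≥ 1, a β · b < T ∧ TypShellCondUKPc ρ β b n ε δ` at a grade with `ε·shellCount n < 1` yields, for
every target `τ > 0`, such a family at a grade `(n', ε')` with `1 ≤ n'`, `0 < ε'`, `ε'·shellCount n' < τ` — same meshes, and the
calibration constant of budget `δ` is the old one of the budget `δ₀(δ) ≤ δ`. -/
theorem sharpFamily_grade_free (hρ : Continuous ρ) {a : ℝ → ℝ} {n : ℕ} {ε : ℝ} (hε : 0 ≤ ε) (hεM : ε * shellCount n < 1)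
    (h : ∀ δ : ℝ, 0 < δ → ∃ T β₂ : ℝ, ∀ β : ℝ, β₂ ≤ β →
      ∃ b : ℕ, 1 ≤ b ∧ a β * (b : ℝ) < T ∧ TypShellCondUKPc ρ β b n ε δ)
    {τ : ℝ} (hτ : 0 < τ) :
    ∃ (n' : ℕ) (ε' : ℝ), 1 ≤ n' ∧ 0 < ε' ∧ ε' * shellCount n' < τ ∧
      ∀ δ : ℝ, 0 < δ → ∃ T β₂ : ℝ, ∀ β : ℝ, β₂ ≤ β →
        ∃ b : ℕ, 1 ≤ b ∧ a β * (b : ℝ) < T ∧ TypShellCondUKPc ρ β b n' ε' δ := by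
  have hSn : 0 ≤ shellCount n := by
    unfold Summit.QuantumFields.YangMills.Cruxes.IR.OnsetFormats.shellCount; positivity
  have hq0 : 0 ≤ ε * shellCount n := mul_nonneg hε hSn
  obtain ⟨j, hj1, hj⟩ := exists_bootstrap_exponent_lt hq0 hεM (half_pos hτ) n
  set S : ℝ := shellCount (j * (2 * n + 1)) with hS
  have hS0 : 0 ≤ S := by
    rw [hS]; unfold Summit.QuantumFields.YangMills.Cruxes.IR.OnsetFormats.shellCount; positivity
  set ε' : ℝ := (ε * shellCount n) ^ j + τ / 2 / (S + 1) with hε'def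
  have hη : 0 < τ / 2 / (S + 1) := by positivity
  have hε'gt : (ε * shellCount n) ^ j < ε' := by linarith
  have hK : 0 ≤ (2 + 3 * ε) * shellCount n := mul_nonneg (by linarith) hSn
  refine ⟨j * (2 * n + 1), ε', ?_, ?_, ?_, fun δ hδ => ?_⟩
  · calc 1 ≤ j := hj1
      _ ≤ j * (2 * n + 1) := Nat.le_mul_of_pos_right j (by omega)
  · have : 0 ≤ (ε * shellCount n) ^ j := pow_nonneg hq0 j
    linarith
  · have h1 : τ / 2 / (S + 1) * S ≤ τ / 2 := by
      rw [div_mul_eq_mul_div, div_le_iff₀ (by positivity)]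
      nlinarith [hS0, hτ]
    rw [hε'def, add_mul]
    linarith
  · obtain ⟨δ₀, hδ₀, hδ₀δ, hδ₀ε⟩ := exists_budget (j := j) hK hε'gt hδ
    obtain ⟨T, β₂, hβ⟩ := h δ₀ hδ₀
    refine ⟨T, β₂, fun β hb => ?_⟩
    obtain ⟨b, hb1, hcal, hT⟩ := hβ β hb
    exact ⟨b, hb1, hcal, typShellCondUKPc_point_robust hρ hb1 hε hεM.le hδ₀ hδ₀δ j hδ₀ε hT⟩

end Point

/-- **I♯_SC with the Dobrushin–Shlosman threshold `< 1` in place of the registered `≤ 3/4`** — EQUIVALENT. -/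
theorem onsetSharpUKPcSC_iff_lt_one :
    OnsetSharpUKPcSC ↔
    ∀ (G : Type) [Group G] [TopologicalSpace G] [IsTopologicalGroup G] [CompactSpace G],
      IsCompactSimpleLieGroup G → SimplyConnectedSpace G →
      letI : MeasurableSpace G := borel G; haveI : BorelSpace G := ⟨rfl⟩;
      ∀ (r : LatticeRep G) (a : ℝ → ℝ), (∀ β, 0 < a β) → Tendsto a atTop (𝓝 0) → LowerBounds G r a →
        ∃ (n : ℕ) (ε : ℝ), 1 ≤ n ∧ 0 ≤ ε ∧ ε * shellCount n < 1 ∧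
          ∀ δ : ℝ, 0 < δ → ∃ T β₂ : ℝ, ∀ β : ℝ, β₂ ≤ β →
            ∃ b : ℕ, 1 ≤ b ∧ a β * (b : ℝ) < T ∧ TypShellCondUKPc r.ρ β b n ε δ := by
  constructor
  · intro h G _ _ _ _ hG hsc
    letI : MeasurableSpace G := borel G
    haveI : BorelSpace G := ⟨rfl⟩
    intro r a ha hat hlb
    obtain ⟨n, ε, hn, hε, hM, hfam⟩ := h G hG hsc r a ha hat hlb
    exact ⟨n, ε, hn, hε, by linarith, hfam⟩
  · intro h G _ _ _ _ hG hsc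
    letI : MeasurableSpace G := borel G
    haveI : BorelSpace G := ⟨rfl⟩
    intro r a ha hat hlb
    haveI : T2Space G := T2Space.of_injective_continuous r.injective r.continuous
    haveI : SecondCountableTopology G :=
      (r.continuous.isClosedEmbedding r.injective).isEmbedding.secondCountableTopology
    obtain ⟨n, ε, _, hε, hM, hfam⟩ := h G hG hsc r a ha hat hlb
    obtain ⟨n', ε', hn', hε', hlt, hfam'⟩ := sharpFamily_grade_free r.continuous hε hM hfam (by norm_num : (0 : ℝ) < 3 / 4)
    exact ⟨n', ε', hn', hε'.le, hlt.le, hfam'⟩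

/-- **Grade freedom of I♯_SC**: `OnsetSharpUKPcSC` delivers, for every simply connected compact simple `G`, every `r`, every unit
map `a` with `LowerBounds G r a` and EVERY target `τ > 0`, the calibrated typical-onset family at a grade `(n, ε)` with
`ε·shellCount n < τ` (the registered constant `3/4` is immaterial; meshes and calibration unchanged). -/
theorem onsetSharpUKPcSC_grade_free (h : OnsetSharpUKPcSC) (G : Type) [Group G] [TopologicalSpace G]
    [IsTopologicalGroup G] [CompactSpace G] (hG : IsCompactSimpleLieGroup G) (hsc : SimplyConnectedSpace G) {τ : ℝ}
    (hτ : 0 < τ) :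
    letI : MeasurableSpace G := borel G; haveI : BorelSpace G := ⟨rfl⟩;
    ∀ (r : LatticeRep G) (a : ℝ → ℝ), (∀ β, 0 < a β) → Tendsto a atTop (𝓝 0) → LowerBounds G r a →
      ∃ (n : ℕ) (ε : ℝ), 1 ≤ n ∧ 0 < ε ∧ ε * shellCount n < τ ∧
        ∀ δ : ℝ, 0 < δ → ∃ T β₂ : ℝ, ∀ β : ℝ, β₂ ≤ β →
          ∃ b : ℕ, 1 ≤ b ∧ a β * (b : ℝ) < T ∧ TypShellCondUKPc r.ρ β b n ε δ := by
  letI : MeasurableSpace G := borel G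
  haveI : BorelSpace G := ⟨rfl⟩
  intro r a ha hat hlb
  haveI : T2Space G := T2Space.of_injective_continuous r.injective r.continuous
  haveI : SecondCountableTopology G :=
    (r.continuous.isClosedEmbedding r.injective).isEmbedding.secondCountableTopology
  obtain ⟨n, ε, _, hε, hM, hfam⟩ := h G hG hsc r a ha hat hlb
  exact sharpFamily_grade_free r.continuous hε (by linarith) hfam hτ

end Summit.QuantumFields.YangMills.Cruxes.IR.AfPincerUc.SharpOnset

end
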